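import Mathlib
import Literature.Analysis.FluidPDE.VectorCalculus
import Literature.Analysis.FluidPDE.SwirlTransportProofs

/-!
# Route `FilamentSkeletonRss` · crux `TransverseReductionRJ` (stmt-NavierStokesRegularity-21221) — line `kelvin_gate`,
# stub S2 `PolynomialKelvinGate`: pointwise calculus of the rotating-Leray profile operator and its linearisation

Helper file (theorems only, `--supports stmt-NavierStokesRegularity-21221 --as helper`).  HONEST FRAMING: bookkeeping
for a HYPOTHETICAL filament-type RSS blow-up route; nothing here bears on Navier–Stokes regularity, and nothing here
proves the stub.  What is here is the elementary calculus every construction of a Kelvin gate (a LINEAR right inverse of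
the linearised profile operator) starts from, stated for the EXPLICIT pointwise expressions of the registered line
`Cruxes/TransverseReductionRJ/Lines/kelvin_gate.lean` (so that the lemmas apply by `rfl` to its `lerayOp` / `lerayLin`,
and equally to the importable copies `Theorems.KelvinGate.lerayOp` / `lerayLin`):

* `E_α(U)(y) = α (e₃ × U(y) − DU(y)[e₃ × y]) + ½ U(y) + ½ DU(y)[y] − ΔU(y) + DU(y)[U(y)]` (the crux's profile operator,
  velocity part; Pineau–Vicol's rotated Leray system (1.8a));
* `𝓛_(α,U⁰) W (y) = α (e₃ × W − DW[e₃ × y]) + ½ W + ½ DW[y] − ΔW + DW[U⁰] + DU⁰[W]` (its linearisation).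

Results:
* `cross_single_two_eq_rotGen` — the crux's `e₃ × v` is the tree's rotation generator `rotGen v` (bilinearity of `×`
  is used through the tree's bundled `crossCLM`);
* `lerayLin_formula_add_smul` — `𝓛` is LINEAR in `W` at every point where the two fields are `C²`
  (`𝓛(W₁ + s W₂) = 𝓛 W₁ + s 𝓛 W₂`);
* `lerayOp_formula_add` — the EXPANSION `E_α(U⁰ + W) = E_α(U⁰) + 𝓛_(α,U⁰) W + DW[W]` at every point where `U⁰, W`
  are `C²` (so `𝓛` is the linearisation and `DW[W]` the exact quadratic remainder — the identity behind stub S3's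
  contraction and behind the very notion of a gate in stub S2).
-/

set_option linter.dupNamespace false

noncomputable section

namespace Summit.NavierStokesRegularity.NavierStokesRegularity.Theorems

open Set Function
open Literature.Analysis.FluidPDE
open scoped InnerProductSpace Laplacian ContDiff Topology

namespace KelvinGate

/-! ## The rotation generator `e₃ × ·` -/

/-- The crux's rotation field `e₃ × v` (`cross (EuclideanSpace.single 2 1) v`) IS the tree's infinitesimal rotation
generator `rotGen v = (−v₁, v₀, 0)` (componentwise computation of the cross product). -/
theorem cross_single_two_eq_rotGen (v : EuclideanSpace ℝ (Fin 3)) :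
    cross (EuclideanSpace.single 2 1) v = rotGen v := by
  ext i
  fin_cases i <;> simp [cross, rotGen, crossProduct]

/-! ## Linearity of the linearised profile operator -/

/-- **`𝓛_(α,U⁰)` is linear in `W`** (pointwise, at any `y` where `W₁, W₂` are `C²`):
`𝓛(W₁ + s W₂)(y) = 𝓛 W₁ (y) + s 𝓛 W₂ (y)` for the explicit linearised rotating-Leray profile operator
`𝓛 W (y) = α (e₃ × W(y) − DW(y)[e₃ × y]) + ½ W(y) + ½ DW(y)[y] − ΔW(y) + DW(y)[U⁰(y)] + DU⁰(y)[W(y)]`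
(additivity of `fderiv` at differentiable points, of `Δ` at `C²` points, bilinearity of `×`, linearity of `DU⁰(y)`). -/
theorem lerayLin_formula_add_smul (α s : ℝ) (U0 W₁ W₂ : EuclideanSpace ℝ (Fin 3) → EuclideanSpace ℝ (Fin 3))
    (y : EuclideanSpace ℝ (Fin 3)) (h₁ : ContDiffAt ℝ 2 W₁ y) (h₂ : ContDiffAt ℝ 2 W₂ y) :
    α • (cross (EuclideanSpace.single 2 1) ((fun z => W₁ z + s • W₂ z) y) -
          fderiv ℝ (fun z => W₁ z + s • W₂ z) y (cross (EuclideanSpace.single 2 1) y)) +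
        (1/2:ℝ) • (fun z => W₁ z + s • W₂ z) y + (1/2:ℝ) • fderiv ℝ (fun z => W₁ z + s • W₂ z) y y -
        (Δ (fun z => W₁ z + s • W₂ z)) y + fderiv ℝ (fun z => W₁ z + s • W₂ z) y (U0 y) +
        fderiv ℝ U0 y ((fun z => W₁ z + s • W₂ z) y) =
      (α • (cross (EuclideanSpace.single 2 1) (W₁ y) - fderiv ℝ W₁ y (cross (EuclideanSpace.single 2 1) y)) +
        (1/2:ℝ) • W₁ y + (1/2:ℝ) • fderiv ℝ W₁ y y - (Δ W₁) y + fderiv ℝ W₁ y (U0 y) + fderiv ℝ U0 y (W₁ y)) +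
      s • (α • (cross (EuclideanSpace.single 2 1) (W₂ y) - fderiv ℝ W₂ y (cross (EuclideanSpace.single 2 1) y)) +
        (1/2:ℝ) • W₂ y + (1/2:ℝ) • fderiv ℝ W₂ y y - (Δ W₂) y + fderiv ℝ W₂ y (U0 y) + fderiv ℝ U0 y (W₂ y)) := by
  have hd₁ : DifferentiableAt ℝ W₁ y := h₁.differentiableAt (by norm_num)
  have hd₂ : DifferentiableAt ℝ W₂ y := h₂.differentiableAt (by norm_num)
  have h₂s : ContDiffAt ℝ 2 (fun z => s • W₂ z) y := h₂.const_smul s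
  have hsum : (fun z => W₁ z + s • W₂ z) = W₁ + s • W₂ := rfl
  have hsW : (fun z => s • W₂ z) = s • W₂ := rfl
  have hD : fderiv ℝ (fun z => W₁ z + s • W₂ z) y = fderiv ℝ W₁ y + s • fderiv ℝ W₂ y := by
    rw [fderiv_fun_add (f := W₁) (g := fun z => s • W₂ z) hd₁ (hd₂.const_smul s),
      fderiv_fun_const_smul hd₂]
  have hL : (Δ (fun z => W₁ z + s • W₂ z)) y = (Δ W₁) y + s • (Δ W₂) y := by
    rw [hsum, h₁.laplacian_add (by rw [← hsW]; exact h₂s), InnerProductSpace.laplacian_smul s h₂]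
  rw [hD, hL]
  simp only [← crossCLM_apply, map_add, map_smul, _root_.add_apply, _root_.smul_apply, smul_add, smul_sub]
  module

/-! ## The expansion `E(U⁰ + W) = E(U⁰) + 𝓛 W + DW[W]` -/

/-- **Exact second-order expansion of the profile operator** (pointwise, at any `y` where `U⁰, W` are `C²`):
`E_α(U⁰ + W)(y) = E_α(U⁰)(y) + 𝓛_(α,U⁰) W (y) + DW(y)[W(y)]`, where
`E_α(U)(y) = α (e₃ × U(y) − DU(y)[e₃ × y]) + ½ U(y) + ½ DU(y)[y] − ΔU(y) + DU(y)[U(y)]` and `𝓛` is as in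
`lerayLin_formula_add_smul`.  Every term of `E_α` is linear in `U` except the convective one, whose polarisation
`D(U⁰+W)[U⁰+W] = DU⁰[U⁰] + (DW[U⁰] + DU⁰[W]) + DW[W]` produces the two cross terms of `𝓛` and the quadratic remainder. -/
theorem lerayOp_formula_add (α : ℝ) (U0 W : EuclideanSpace ℝ (Fin 3) → EuclideanSpace ℝ (Fin 3))
    (y : EuclideanSpace ℝ (Fin 3)) (hU : ContDiffAt ℝ 2 U0 y) (hW : ContDiffAt ℝ 2 W y) :
    α • (cross (EuclideanSpace.single 2 1) ((fun z => U0 z + W z) y) -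
          fderiv ℝ (fun z => U0 z + W z) y (cross (EuclideanSpace.single 2 1) y)) +
        (1/2:ℝ) • (fun z => U0 z + W z) y + (1/2:ℝ) • fderiv ℝ (fun z => U0 z + W z) y y -
        (Δ (fun z => U0 z + W z)) y + fderiv ℝ (fun z => U0 z + W z) y ((fun z => U0 z + W z) y) =
      (α • (cross (EuclideanSpace.single 2 1) (U0 y) - fderiv ℝ U0 y (cross (EuclideanSpace.single 2 1) y)) +
        (1/2:ℝ) • U0 y + (1/2:ℝ) • fderiv ℝ U0 y y - (Δ U0) y + fderiv ℝ U0 y (U0 y)) +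
      (α • (cross (EuclideanSpace.single 2 1) (W y) - fderiv ℝ W y (cross (EuclideanSpace.single 2 1) y)) +
        (1/2:ℝ) • W y + (1/2:ℝ) • fderiv ℝ W y y - (Δ W) y + fderiv ℝ W y (U0 y) + fderiv ℝ U0 y (W y)) +
      fderiv ℝ W y (W y) := by
  have hdU : DifferentiableAt ℝ U0 y := hU.differentiableAt (by norm_num)
  have hdW : DifferentiableAt ℝ W y := hW.differentiableAt (by norm_num)
  have hsum : (fun z => U0 z + W z) = U0 + W := rfl
  have hD : fderiv ℝ (fun z => U0 z + W z) y = fderiv ℝ U0 y + fderiv ℝ W y := fderiv_fun_add hdU hdW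
  have hL : (Δ (fun z => U0 z + W z)) y = (Δ U0) y + (Δ W) y := by
    rw [hsum, hU.laplacian_add hW]
  rw [hD, hL]
  simp only [← crossCLM_apply, map_add, _root_.add_apply, smul_add, smul_sub]
  abel

end KelvinGate

end Summit.NavierStokesRegularity.NavierStokesRegularity.Theorems
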